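import Summits.Ventures.Crystal3D.Theorems.StickyWulffConstantPolycrystalWulffBoundExteriorCalculus
import Summits.Ventures.Crystal3D.Theorems.StickyWulffConstantTextureLiminfRungPerBox

/-!
# `PolycrystalWulffBound`: EXTERIOR CROSS SUMS of a polyhedral texture (set-level, every body `K`)

Route `StickyWulffConstant` of the venture `Summits/Ventures/Crystal3D`, crux `PolycrystalWulffBound`
(item `stmt-Ventures-19482`), second prover lane (poly-p2).  For a texture of pairwise disjoint
polyhedral grains `G_f` (`f : Fin n`; each a finite union of open `H`-polytopes, finite volume) we
refine ALL grain pieces together with a BOUNDING BOX into one family of cells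
(`exists_full_refinement_of_volume_lt_top`, gen 0), index the cells of grain `f` by `S f` and the
box cells outside the texture by `SX`, and prove (`exists_exterior_crossSums`):

* (walls)     `per K (G f) + per K (G g) − per K (G f ∪ G g) = crossSum_K(S f, S g)`   (`f ≠ g`, every
  compact convex `K ∋ 0`) — twice the crux's interface `ι_K(G f, G g)` is a cross-cell facet sum,
  hence `≥ 0` and MONOTONE in `K` (`crossSum_mono`);
* (exterior)  `2·per K (G f) = Σ_{g ≠ f} (per K (G f) + per K (G g) − per K (G f ∪ G g)) + crossSum_K(S f, SX)`
  for origin-symmetric `K` — the free energy `per K (G f) − Σ_{g≠f} ι_K(G f, G g)` of a grain is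
  HALF ITS CROSS SUM WITH THE EXTERIOR CELLS;
* (total)     `2·per K (⋃ f, G f) = Σ_f crossSum_K(S f, SX)` for origin-symmetric `K`.

Everything is the core identity `…ExteriorCalculus.two_mul_per_eq_crossSum_compl` (clause (B) +
hole rule) applied inside the box.  No facet matching, no structure theory.
WHAT THIS IS NOT: anything on grains in contact beyond bookkeeping; the crux is not claimed.
-/

noncomputable section

namespace Summit.Ventures.Crystal3D.Theorems

open MeasureTheory Set
open scoped RealInnerProductSpace ENNReal Pointwise
open Summit.Ventures.Crystal3D.Cruxes.TextureLiminf.TexShadow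
open Literature.Analysis.Convexity

/-- The coordinate box `Rungs.box a b` is an open `H`-polytope, hence open and measurable, and it
is bounded. -/
theorem box_isOpen_isBounded (a b : E3) :
    IsOpen (Rungs.box a b) ∧ Bornology.IsBounded (Rungs.box a b) := by
  refine ⟨?_, ?_⟩
  · rw [Rungs.box_eq_iInter]
    exact isOpen_openHPolytope _
  · have hc : IsCompact ((WithLp.toLp 2) '' Set.Icc (WithLp.ofLp a) (WithLp.ofLp b) : Set E3) :=
      isCompact_Icc.image (PiLp.continuous_toLp 2 _)
    exact hc.isBounded.subset fun x hx =>
      ⟨WithLp.ofLp x, ⟨fun t => (hx t).1.le, fun t => (hx t).2.le⟩, WithLp.toLp_ofLp _ _⟩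

/-- The coordinate box has finite `K`-perimeter for every compact convex `K ∋ 0`. -/
theorem perK_box_ne_top {K : Set E3} (hK : IsCompact K) (hKc : Convex ℝ K) (h0 : (0 : E3) ∈ K)
    {a b : E3} (hab : ∀ t, a t < b t) : perK K (Rungs.box a b) ≠ ⊤ := by
  rw [perK_eq_anisotropicPerimeter, show Rungs.box a b = {x : E3 | ∀ t, a t < x t ∧ x t < b t}
    from rfl, anisotropicPerimeter_box hK hKc h0 hab]
  exact ENNReal.ofReal_ne_top

/-- **Exterior cross sums of a polyhedral texture.**  Let `G : Fin n → Set E3` be pairwise disjoint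
polyhedral grains (`G f = ⋃ i, polytope (H_f i)`) of finite volume.  Then there are cells
`Q_j = polytope (H j)`, `j : Fin k`, common-plane normals `ν`, index sets `S f` (the cells of grain
`f`) and `SX` (exterior cells) such that, writing
`crossSum_K(s, t) = Σ_{a∈s} Σ_{b∈t} [a<b ? T_K a b : T_K b a]`,
`T_K a b = (h_K(ν a b) + h_K(−ν a b))·facetArea(Q̄_a ∩ Q̄_b)(ν a b)`:
(walls) `per K (G f) + per K (G g) − per K (G f ∪ G g) = crossSum_K(S f, S g)` for `f ≠ g` and
every compact convex `K ∋ 0`; (exterior) for `−K = K`,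
`2·per K (G f) = Σ_{g ∈ univ.erase f} (per K (G f) + per K (G g) − per K (G f ∪ G g)) + crossSum_K(S f, SX)`;
(total) for `−K = K`, `2·per K (⋃ f, G f) = Σ_f crossSum_K(S f, SX)`. -/
theorem exists_exterior_crossSums {n : ℕ} (G : Fin n → Set E3)
    (hPoly : ∀ f, ∃ (k : ℕ) (H : Fin k → Finset (E3 × ℝ)), G f = ⋃ i, polytope (H i))
    (hvol : ∀ f, volume (G f) < ⊤) (hdisjG : ∀ f g, f ≠ g → Disjoint (G f) (G g)) :
    ∃ (k : ℕ) (H : Fin k → Finset (E3 × ℝ)) (ν : Fin k → Fin k → E3)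
      (S : Fin n → Finset (Fin k)) (SX : Finset (Fin k)),
      (∀ K : Set E3, IsCompact K → Convex ℝ K → (0 : E3) ∈ K → ∀ f g, f ≠ g →
        per K (G f) + per K (G g) - per K (G f ∪ G g) =
          ∑ a ∈ S f, ∑ b ∈ S g,
            (if a < b then (supportFn K (ν a b) + supportFn K (-ν a b)) *
                facetArea (closure (polytope (H a)) ∩ closure (polytope (H b))) (ν a b)
              else (supportFn K (ν b a) + supportFn K (-ν b a)) *
                facetArea (closure (polytope (H b)) ∩ closure (polytope (H a))) (ν b a))) ∧
      (∀ K : Set E3, IsCompact K → Convex ℝ K → (0 : E3) ∈ K → -K = K → ∀ f,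
        2 * per K (G f) =
          (∑ g ∈ Finset.univ.erase f, (per K (G f) + per K (G g) - per K (G f ∪ G g))) +
          ∑ a ∈ S f, ∑ b ∈ SX,
            (if a < b then (supportFn K (ν a b) + supportFn K (-ν a b)) *
                facetArea (closure (polytope (H a)) ∩ closure (polytope (H b))) (ν a b)
              else (supportFn K (ν b a) + supportFn K (-ν b a)) *
                facetArea (closure (polytope (H b)) ∩ closure (polytope (H a))) (ν b a))) ∧
      (∀ K : Set E3, IsCompact K → Convex ℝ K → (0 : E3) ∈ K → -K = K →
        2 * per K (⋃ f, G f) =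
          ∑ f, ∑ a ∈ S f, ∑ b ∈ SX,
            (if a < b then (supportFn K (ν a b) + supportFn K (-ν a b)) *
                facetArea (closure (polytope (H a)) ∩ closure (polytope (H b))) (ν a b)
              else (supportFn K (ν b a) + supportFn K (-ν b a)) *
                facetArea (closure (polytope (H b)) ∩ closure (polytope (H a))) (ν b a))) := by
  classical
  choose kf Hf hGf using hPoly
  -- the texture is bounded
  have hbdG : ∀ f, Bornology.IsBounded (G f) := by
    intro f
    rw [hGf f]
    refine Bornology.isBounded_iUnion.2 fun i => ?_
    have hv : volume (⋃ i, polytope (Hf f i)) < ⊤ := by rw [← hGf f]; exact hvol f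
    exact isBounded_piece_of_volume_iUnion_lt_top (Hf f) hv i
  have hbdE : Bornology.IsBounded (⋃ f, G f) := Bornology.isBounded_iUnion.2 hbdG
  obtain ⟨R, hR⟩ := hbdE.subset_closedBall (0 : E3)
  -- the bounding box
  set R' : ℝ := |R| + 1 with hR'
  set a : E3 := WithLp.toLp 2 (fun _ : Fin 3 => -R') with ha
  set b : E3 := WithLp.toLp 2 (fun _ : Fin 3 => R') with hb
  have hat : ∀ t, a t = -R' := fun t => rfl
  have hbt : ∀ t, b t = R' := fun t => rfl
  have hR'pos : 0 < R' := by positivity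
  have hab : ∀ t, a t < b t := fun t => by rw [hat, hbt]; linarith
  have hEbox : closure (⋃ f, G f) ⊆ Rungs.box a b := by
    intro x hx t
    have hx' : x ∈ Metric.closedBall (0 : E3) R := closure_minimal hR Metric.isClosed_closedBall hx
    have hxn : ‖x‖ ≤ R := mem_closedBall_zero_iff.1 hx'
    have h1 : |x t| < R' := by
      -- a coordinate is bounded by the Euclidean norm
      have hxt : |x t| ≤ ‖x‖ := by
        rw [EuclideanSpace.norm_eq, ← Real.sqrt_sq_eq_abs]
        refine Real.sqrt_le_sqrt ?_
        have h := Finset.single_le_sum (f := fun j : Fin 3 => ‖x j‖ ^ 2) (fun j _ => sq_nonneg _)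
          (Finset.mem_univ t)
        simpa [Real.norm_eq_abs, sq_abs] using h
      have hRle : R ≤ |R| := le_abs_self R
      linarith
    rw [hat, hbt]
    exact ⟨by linarith [(abs_lt.1 h1).1], (abs_lt.1 h1).2⟩
  have hEbox' : (⋃ f, G f) ⊆ Rungs.box a b := subset_closure.trans hEbox
  obtain ⟨hbox_open, hbox_bdd⟩ := box_isOpen_isBounded a b
  have hbox_meas : MeasurableSet (Rungs.box a b) := hbox_open.measurableSet
  have hbox_int : interior (Rungs.box a b) = Rungs.box a b := hbox_open.interior_eq
  set HB : Finset (E3 × ℝ) := (Finset.univ.image (fun t => (Rungs.e t, b t)) ∪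
    Finset.univ.image (fun t => (-(Rungs.e t), -(a t)))) with hHB
  have hboxH : polytope HB = Rungs.box a b := (Rungs.box_eq_iInter a b).symm
  -- the pooled family: all grain pieces and the box
  set 𝒢 : Fin n → Finset (Finset (E3 × ℝ)) := fun f => Finset.univ.image (Hf f) with h𝒢
  set 𝒢all : Finset (Finset (E3 × ℝ)) := Finset.univ.biUnion 𝒢 ∪ {HB} with h𝒢all
  have hUf : ∀ f, (⋃ Gp ∈ 𝒢 f, polytope Gp) = G f := by
    intro f
    show (⋃ Gp ∈ Finset.univ.image (Hf f), polytope Gp) = G f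
    rw [hGf f, Finset.set_biUnion_finset_image, biUnion_univ_eq_iUnion]
  have hUall : (⋃ Gp ∈ 𝒢all, polytope Gp) = Rungs.box a b := by
    show (⋃ Gp ∈ Finset.univ.biUnion 𝒢 ∪ {HB}, polytope Gp) = Rungs.box a b
    rw [Finset.set_biUnion_union, Finset.set_biUnion_biUnion, Finset.set_biUnion_singleton,
      hboxH]
    refine union_eq_right.2 ?_
    intro x hx
    rw [mem_iUnion₂] at hx
    obtain ⟨f, -, hxf⟩ := hx
    rw [hUf f] at hxf
    exact hEbox' (mem_iUnion.2 ⟨f, hxf⟩)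
  have hvall : volume (⋃ Gp ∈ 𝒢all, ⋂ p ∈ Gp, {x : E3 | ⟪p.1, x⟫ < p.2}) < ⊤ := by
    show volume (⋃ Gp ∈ 𝒢all, polytope Gp) < ⊤
    rw [hUall]
    exact hbox_bdd.measure_lt_top
  -- the common refinement
  obtain ⟨k, H, ν, hne, -, hbd, hunit, hdist, hdisj, hplane, -, hae, -, hfam⟩ :=
    exists_full_refinement_of_volume_lt_top (E := E3) 𝒢all hvall
  change ∀ j, (polytope (H j)).Nonempty at hne
  change ∀ j, Bornology.IsBounded (polytope (H j)) at hbd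
  change ∀ j j', j ≠ j' → Disjoint (polytope (H j)) (polytope (H j')) at hdisj
  change ∀ j j', j ≠ j' → ‖ν j j'‖ = 1 ∧ ∃ b : ℝ,
    closure (polytope (H j)) ∩ closure (polytope (H j')) ⊆ {x | ⟪ν j j', x⟫ = b} at hplane
  change (⋃ Gp ∈ 𝒢all, polytope Gp) =ᵐ[volume] ⋃ j, polytope (H j) at hae
  change ∀ 𝒢' : Finset (Finset (E3 × ℝ)), 𝒢' ⊆ 𝒢all →
    (⋃ Gp ∈ 𝒢', polytope Gp) =ᵐ[volume]
      ⋃ (j) (_ : ∃ Gp ∈ 𝒢', polytope (H j) ⊆ polytope Gp), polytope (H j) at hfam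
  rw [hUall] at hae
  -- index sets
  set S : Fin n → Finset (Fin k) := fun f =>
    Finset.univ.filter (fun j => ∃ Gp ∈ 𝒢 f, polytope (H j) ⊆ polytope Gp) with hS
  set SE : Finset (Fin k) := Finset.univ.biUnion S with hSE
  set SX : Finset (Fin k) := Finset.univ \ SE with hSX
  have h𝒢sub : ∀ f, 𝒢 f ⊆ 𝒢all := fun f =>
    (Finset.subset_biUnion_of_mem 𝒢 (Finset.mem_univ f)).trans Finset.subset_union_left
  -- the cells of grain `f` exhaust it a.e. and lie inside it
  have hGS : ∀ f, G f =ᵐ[volume] ⋃ j ∈ S f, polytope (H j) := by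
    intro f
    have h := hfam (𝒢 f) (h𝒢sub f)
    rw [hUf f] at h
    refine h.trans (Filter.EventuallyEq.of_eq ?_)
    ext x
    simp only [hS, Finset.mem_filter, Finset.mem_univ, true_and]
  have hSsub : ∀ f, (⋃ j ∈ S f, polytope (H j)) ⊆ G f := by
    intro f x hx
    rw [mem_iUnion₂] at hx
    obtain ⟨j, hj, hxj⟩ := hx
    obtain ⟨Gp, hGp, hjG⟩ := (Finset.mem_filter.1 hj).2
    rw [← hUf f]
    exact mem_iUnion₂.2 ⟨Gp, hGp, hjG hxj⟩
  have hSdisj : ∀ f g, f ≠ g → Disjoint (S f) (S g) := by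
    intro f g hfg
    rw [Finset.disjoint_left]
    intro j hjf hjg
    obtain ⟨Gp, hGp, hjG⟩ := (Finset.mem_filter.1 hjf).2
    obtain ⟨Gp', hGp', hjG'⟩ := (Finset.mem_filter.1 hjg).2
    obtain ⟨x, hx⟩ := hne j
    have hxf : x ∈ G f := by rw [← hUf f]; exact mem_iUnion₂.2 ⟨Gp, hGp, hjG hx⟩
    have hxg : x ∈ G g := by rw [← hUf g]; exact mem_iUnion₂.2 ⟨Gp', hGp', hjG' hx⟩
    exact Set.disjoint_left.1 (hdisjG f g hfg) hxf hxg
  have hUSE : (⋃ j ∈ SE, polytope (H j)) = ⋃ f, ⋃ j ∈ S f, polytope (H j) := by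
    rw [hSE, Finset.set_biUnion_biUnion, biUnion_univ_eq_iUnion]
  have hESE : (⋃ f, G f) =ᵐ[volume] ⋃ j ∈ SE, polytope (H j) := by
    rw [hUSE]
    exact Filter.EventuallyEq.countable_iUnion hGS
  have hSEsub : (⋃ j ∈ SE, polytope (H j)) ⊆ ⋃ f, G f := by
    rw [hUSE]
    exact iUnion_mono hSsub
  -- the cells of the grains stay inside the box
  have hclS : ∀ f, closure (⋃ j ∈ S f, polytope (H j)) ⊆ interior (Rungs.box a b) := by
    intro f
    rw [hbox_int]
    exact (closure_mono ((hSsub f).trans (subset_iUnion G f))).trans hEbox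
  have hclE : closure (⋃ j ∈ SE, polytope (H j)) ⊆ interior (Rungs.box a b) := by
    rw [hbox_int]
    exact (closure_mono hSEsub).trans hEbox
  -- the complementary index set of `S f` splits into the other grains and the exterior
  have hcompl : ∀ f, Finset.univ \ S f = (Finset.univ.erase f).biUnion S ∪ SX := by
    intro f
    ext j
    rw [Finset.mem_sdiff, Finset.mem_union, Finset.mem_biUnion, hSX, Finset.mem_sdiff, hSE,
      Finset.mem_biUnion]
    constructor
    · rintro ⟨-, hj⟩
      by_cases h : ∃ g, j ∈ S g
      · obtain ⟨g, hg⟩ := h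
        exact Or.inl ⟨g, Finset.mem_erase.2 ⟨fun hgf => hj (hgf ▸ hg), Finset.mem_univ g⟩, hg⟩
      · exact Or.inr ⟨Finset.mem_univ j, fun ⟨g, _, hg⟩ => h ⟨g, hg⟩⟩
    · rintro (⟨g, hg, hjg⟩ | ⟨-, h⟩)
      · exact ⟨Finset.mem_univ j, fun hjf =>
          Finset.disjoint_left.1 (hSdisj g f (Finset.mem_erase.1 hg).1) hjg hjf⟩
      · exact ⟨Finset.mem_univ j, fun hjf => h ⟨f, Finset.mem_univ f, hjf⟩⟩
  have hdisjX : ∀ f, Disjoint ((Finset.univ.erase f).biUnion S) SX := by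
    intro f
    rw [Finset.disjoint_left]
    intro j hj hjX
    obtain ⟨g, -, hg⟩ := Finset.mem_biUnion.1 hj
    exact (Finset.mem_sdiff.1 hjX).2 (Finset.mem_biUnion.2 ⟨g, Finset.mem_univ g, hg⟩)
  have hpwd : ∀ s : Finset (Fin n), (↑s : Set (Fin n)).PairwiseDisjoint S :=
    fun s f _ g _ hfg => hSdisj f g hfg
  refine ⟨k, H, ν, S, SX, ?_, ?_, ?_⟩
  · -- (walls)
    intro K hK hKc h0 f g hfg
    have h := per_add_per_sub_per_union_eq_crossSum_of_polytopeCalculus stub_polytopeCalculus hK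
      hKc h0 H ν hbd hdisj hplane (hSdisj f g hfg)
    rw [Finset.set_biUnion_union, ← per_congr_ae K (hGS f), ← per_congr_ae K (hGS g),
      ← per_congr_ae K ((hGS f).union (hGS g))] at h
    exact h
  · -- (exterior)
    intro K hK hKc h0 hKs f
    have h := two_mul_per_eq_crossSum_compl hK hKc h0 hKs H ν hbd hunit hdist hdisj hplane
      hbox_meas hae (perK_box_ne_top hK hKc h0 hab) (S f) (hclS f)
    rw [← per_congr_ae K (hGS f), hcompl f] at h
    rw [h]
    simp_rw [Finset.sum_union (hdisjX f), Finset.sum_biUnion (hpwd (Finset.univ.erase f))]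
    rw [Finset.sum_add_distrib]
    congr 1
    rw [Finset.sum_comm]
    refine Finset.sum_congr rfl fun g hg => ?_
    have hgf : f ≠ g := fun h => (Finset.mem_erase.1 hg).1 h.symm
    have hw := per_add_per_sub_per_union_eq_crossSum_of_polytopeCalculus stub_polytopeCalculus hK
      hKc h0 H ν hbd hdisj hplane (hSdisj f g hgf)
    rw [Finset.set_biUnion_union, ← per_congr_ae K (hGS f), ← per_congr_ae K (hGS g),
      ← per_congr_ae K ((hGS f).union (hGS g))] at hw
    exact hw.symm
  · -- (total)
    intro K hK hKc h0 hKs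
    have h := two_mul_per_eq_crossSum_compl hK hKc h0 hKs H ν hbd hunit hdist hdisj hplane
      hbox_meas hae (perK_box_ne_top hK hKc h0 hab) SE hclE
    rw [← per_congr_ae K hESE, ← hSX] at h
    rw [h, hSE, Finset.sum_biUnion (hpwd Finset.univ)]

end Summit.Ventures.Crystal3D.Theorems

end
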